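import Literature.MathematicalPhysics.QuantumFieldTheory.ONArchipelagoSingletTail
import Literature.MathematicalPhysics.QuantumFieldTheory.ConformalBootstrap3D.MixedEvenHead
import HarnessLib

/-!
# The light singlet rows of an `O(N)` archipelago point certificate from head cells

Tenth file of the archipelago rung.  `ONArchipelagoSingletTail.lean` closed the singlet (`S`) rows for
`Δ ≥ E₀` termwise; this file closes the LIGHT singlet rows — the items `scalar_S` (`ℓ = 0`,
`Δ ∈ [max(Δ_S^*, 1/2), E₀)`) and `spinning_S` (even `ℓ ≠ 0`, `Δ ∈ [ℓ+1, E₀)`) of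
`ArchipelagoObligations` — by HEAD CELLS, literally the pattern of `MixedEvenHead` of the `σ–ε` chain
with the ONE difference that the `(1,1)` entry of the singlet term form
`q_{E,j}(x,y) = x² (Φ_{w₁}[F^{Δ_φ}_-] + Φ_{w₂}[F^{Δ_φ}_+]) + y² Φ_{w₃}[F^{Δ_s}_-] + xy (Φ_{w₅}[F^h_-] + Φ_{w₆}[F^h_+])`,
`h = (Δ_φ+Δ_s)/2` (`singletTermForm`), is a TWO-weight evaluation, bounded below on a box by
`cornerBound₂ (w₁+w₂) (w₁−w₂)` instead of `termCornerBound`.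

On a `Δ`-cell `[a, b)` starting strictly above the unitarity bound the head quadratic form
`x² X(Δ) + y² Y(Δ) + xy W(Δ)` (head set `F`, coefficients `A_{n,j}(Δ,ℓ)/λ_ℓ` enclosed by the interval
tables `hrCoeffLo/Hi a b ℓ`) is PSD uniformly on the cell as soon as three finite sums of closed-form
numbers satisfy `X_lo ≥ 0`, `Y_lo ≥ 0`, `Z_abs² ≤ 4 X_lo Y_lo`
(`singletPositive_ofPoints_of_headSumsI`, regular points; `_Ico`, non-regular points by right limits
inside the cell); the terms off the head set lie in the tail domain where (M_S)/(T_S) apply; hence ONE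
triple of numbers per cell (`singletHeadX`, `singletHeadY`, `singletHeadZ` on the canonical head set
`headSet ℓ n_F`) gives `SingletPositive` on the whole cell at every point of `Q`
(`singletCell_of_headNumbers`), and cell lists glue (`singletPositive_of_cells`, `spinning_S_of_cells`,
`scalar_S_of_cells`).

With this file EVERY row family of an archipelago point certificate has a closed-form kernel rule:
`S` (cells + (M_S)/(T_S)), `T`/`A` (two-sign boxes + apex; light rows by two-sign head cells), `V`
(cells + (M_V)/(T_V)); only the external `2×2` form at the isolated points — implied by the separate
rows when the gaps do not exclude `s`, `φ` (`extPositive_of_separate`) — is left to a direct check.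
No table, no number, no `sorry`.  DECLARATIONS: besides theorems this module DEFINES the four
closed-form head numbers `singletHeadX`, `singletHeadY`, `singletHeadZ` (`headCellSumI` / `headAbsSumI` sums, over
the canonical head set `headSet ℓ n_F`, of the corner bounds `cornerBound₂` / `termCornerBound` of the
weighted point functional) and `singletOffDiagAbs` — the numbers a reader computes once per cell — so
it is a definitions module for the ledger.

Sources: arXiv:1504.07997 §2.2 (`KosPolandSimmonsDuffinVichi2015`); F. Kos, D. Poland,
D. Simmons-Duffin, JHEP 11 (2014) 109, §3.3 eq. (3.16) (`KosPolandSimmonsduffin2014`); M. Hogervorst,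
S. Rychkov, Phys. Rev. D 87 (2013) 106004, §3 eq. (3.9) (`HogervorstRychkov2013`).
-/

noncomputable section

namespace Literature.MathematicalPhysics.QuantumFieldTheory.ONArchipelagoSystem

open Finset Set Filter Topology
open ConformalBootstrap3D (IsConformalBlock3D IsRegularPoint3D unitarityBound3D accidentalDegeneracy3D
  InDescendantRange crossF pointFunctional zMono hrCoeff hrCoeffLo hrCoeffHi legendreLam legendreLam_pos
  hrCoeff_mem_Icc_interval headCellSumI headAbsSumI min_mul_le_mul_of_bounds quadForm_nonneg_of_det
  twoWeightEval sum45_eq_twoWeightEval twoWeightEval_neg cornerBound₂ cornerBound₂_le termCornerBound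
  termCornerBound_le apexRest headSet headSet_off natCast_add_half_le_unitarityBound3D
  eventually_isRegularPoint3D_nhdsGT_of_bound_le)

namespace ArchipelagoFunctional

/-! ### The head quadratic form of the singlet rows -/

/-- The head sum of the singlet term forms splits into the three entry sums.
[cite: KosPolandSimmonsduffin2014, §3.3 eq. (3.16)] -/
theorem sum_singletTermForm_eq {N : ℕ} (z zb : Fin N → ℝ) (w : Fin 7 → Fin N → ℝ) (Δφ Δs Δ : ℝ)
    (F : Finset (ℕ × ℕ)) (c : ℕ × ℕ → ℝ) (x y : ℝ) :
    ∑ q ∈ F, c q * singletTermForm z zb w Δφ Δs (Δ + (q.1 : ℝ)) q.2 x y =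
      x ^ 2 * ∑ q ∈ F, c q *
          (pointFunctional (w 1) z zb (crossF Δφ (-1) (zMono (Δ + (q.1 : ℝ)) q.2)) +
            pointFunctional (w 2) z zb (crossF Δφ 1 (zMono (Δ + (q.1 : ℝ)) q.2))) +
      y ^ 2 * ∑ q ∈ F, c q * pointFunctional (w 3) z zb (crossF Δs (-1) (zMono (Δ + (q.1 : ℝ)) q.2)) +
      x * y * ∑ q ∈ F, c q *
        (pointFunctional (w 5) z zb (crossF ((Δφ + Δs) / 2) (-1) (zMono (Δ + (q.1 : ℝ)) q.2)) +
          pointFunctional (w 6) z zb (crossF ((Δφ + Δs) / 2) 1 (zMono (Δ + (q.1 : ℝ)) q.2))) := by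
  simp only [singletTermForm, Finset.mul_sum, ← Finset.sum_add_distrib]
  exact Finset.sum_congr rfl fun q _ => by ring

/-- **Singlet head cell rule, regular points.** Cell `[a, b]` starting strictly above the unitarity
bound; `Φ¹lo` bounds the two-weight `(1,1)` head terms and `Φ²lo` the `(2,2)` head terms from below and
`Zabs` the off-diagonal head terms in absolute value, uniformly on the cell; the three numbers satisfy
`X_lo ≥ 0`, `Y_lo ≥ 0`, `Z_abs² ≤ 4 X_lo Y_lo`; every singlet term form off `F` on the descendant range
is PSD for `E ∈ [a+n, b+n]`. Then `SingletPositive` at every REGULAR `Δ ∈ [a, b]`.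
[cite: KosPolandSimmonsduffin2014, §3.3 eq. (3.16)] -/
theorem singletPositive_ofPoints_of_headSumsI {N : ℕ} (z zb : Fin N → ℝ) (w : Fin 7 → Fin N → ℝ)
    (hz : ∀ k, z k ∈ Ioo (0 : ℝ) 1) (hzb : ∀ k, zb k ∈ Ioo (0 : ℝ) 1) {ℓ : ℕ} {a b Δφ Δs : ℝ}
    (ha : unitarityBound3D ℓ < a) (F : Finset (ℕ × ℕ)) (Φ₁lo Φ₂lo Zabs : ℕ × ℕ → ℝ)
    (hΦ₁ : ∀ q ∈ F, ∀ Δ ∈ Icc a b,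
      Φ₁lo q ≤ pointFunctional (w 1) z zb (crossF Δφ (-1) (zMono (Δ + (q.1 : ℝ)) q.2)) +
        pointFunctional (w 2) z zb (crossF Δφ 1 (zMono (Δ + (q.1 : ℝ)) q.2)))
    (hΦ₂ : ∀ q ∈ F, ∀ Δ ∈ Icc a b,
      Φ₂lo q ≤ pointFunctional (w 3) z zb (crossF Δs (-1) (zMono (Δ + (q.1 : ℝ)) q.2)))
    (hZ : ∀ q ∈ F, ∀ Δ ∈ Icc a b,
      |pointFunctional (w 5) z zb (crossF ((Δφ + Δs) / 2) (-1) (zMono (Δ + (q.1 : ℝ)) q.2)) +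
        pointFunctional (w 6) z zb (crossF ((Δφ + Δs) / 2) 1 (zMono (Δ + (q.1 : ℝ)) q.2))| ≤ Zabs q)
    (hX : 0 ≤ headCellSumI ℓ a b F Φ₁lo) (hY : 0 ≤ headCellSumI ℓ a b F Φ₂lo)
    (hdet : headAbsSumI ℓ a b F Zabs ^ 2 ≤ 4 * headCellSumI ℓ a b F Φ₁lo * headCellSumI ℓ a b F Φ₂lo)
    (htail : ∀ q : ℕ × ℕ, q ∉ F → InDescendantRange ℓ q.1 q.2 →
      ∀ E ∈ Icc (a + q.1) (b + q.1), ∀ x y : ℝ, 0 ≤ singletTermForm z zb w Δφ Δs E q.2 x y) :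
    ∀ Δ ∈ Icc a b, IsRegularPoint3D Δ ℓ → (ofPoints z zb w).SingletPositive Δφ Δs Δ ℓ := by
  intro Δ hΔ hreg
  have hlt : unitarityBound3D ℓ < Δ := lt_of_lt_of_le ha hΔ.1
  have hlam : 0 < legendreLam ℓ := legendreLam_pos ℓ
  refine singletPositive_ofPoints_of_termwise z zb w hz hzb hlt hreg.2 F ?_ ?_
  · intro x y
    rw [sum_singletTermForm_eq]
    set c : ℕ × ℕ → ℝ := fun q => hrCoeff Δ ℓ q.1 q.2 / legendreLam ℓ with hc
    set X := ∑ q ∈ F, c q *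
        (pointFunctional (w 1) z zb (crossF Δφ (-1) (zMono (Δ + (q.1 : ℝ)) q.2)) +
          pointFunctional (w 2) z zb (crossF Δφ 1 (zMono (Δ + (q.1 : ℝ)) q.2)))
    set Y := ∑ q ∈ F, c q * pointFunctional (w 3) z zb (crossF Δs (-1) (zMono (Δ + (q.1 : ℝ)) q.2))
    set W := ∑ q ∈ F, c q *
        (pointFunctional (w 5) z zb (crossF ((Δφ + Δs) / 2) (-1) (zMono (Δ + (q.1 : ℝ)) q.2)) +
          pointFunctional (w 6) z zb (crossF ((Δφ + Δs) / 2) 1 (zMono (Δ + (q.1 : ℝ)) q.2)))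
    have hA : ∀ q : ℕ × ℕ, 0 ≤ hrCoeffLo a b ℓ q.1 q.2 ∧ hrCoeffLo a b ℓ q.1 q.2 ≤ hrCoeff Δ ℓ q.1 q.2 ∧
        hrCoeff Δ ℓ q.1 q.2 ≤ hrCoeffHi a b ℓ q.1 q.2 :=
      fun q => hrCoeff_mem_Icc_interval ha hΔ.1 hΔ.2 q.1 q.2
    -- diagonal entries: `X ≥ X_lo/λ`, `Y ≥ Y_lo/λ`
    have hXlo : headCellSumI ℓ a b F Φ₁lo / legendreLam ℓ ≤ X := by
      rw [headCellSumI, Finset.sum_div]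
      refine Finset.sum_le_sum fun q hq => ?_
      have hmin := min_mul_le_mul_of_bounds (hA q).2.1 (hA q).2.2 ((hA q).1.trans (hA q).2.1)
        (hΦ₁ q hq Δ hΔ)
      have hrw : c q *
          (pointFunctional (w 1) z zb (crossF Δφ (-1) (zMono (Δ + (q.1 : ℝ)) q.2)) +
            pointFunctional (w 2) z zb (crossF Δφ 1 (zMono (Δ + (q.1 : ℝ)) q.2))) =
          hrCoeff Δ ℓ q.1 q.2 *
            (pointFunctional (w 1) z zb (crossF Δφ (-1) (zMono (Δ + (q.1 : ℝ)) q.2)) +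
              pointFunctional (w 2) z zb (crossF Δφ 1 (zMono (Δ + (q.1 : ℝ)) q.2))) /
              legendreLam ℓ := by
        simp only [hc]; ring
      rw [hrw]
      exact div_le_div_of_nonneg_right hmin hlam.le
    have hYlo : headCellSumI ℓ a b F Φ₂lo / legendreLam ℓ ≤ Y := by
      rw [headCellSumI, Finset.sum_div]
      refine Finset.sum_le_sum fun q hq => ?_
      have hmin := min_mul_le_mul_of_bounds (hA q).2.1 (hA q).2.2 ((hA q).1.trans (hA q).2.1)
        (hΦ₂ q hq Δ hΔ)
      have hrw : c q * pointFunctional (w 3) z zb (crossF Δs (-1) (zMono (Δ + (q.1 : ℝ)) q.2)) =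
          hrCoeff Δ ℓ q.1 q.2 *
            pointFunctional (w 3) z zb (crossF Δs (-1) (zMono (Δ + (q.1 : ℝ)) q.2)) /
              legendreLam ℓ := by
        simp only [hc]; ring
      rw [hrw]
      exact div_le_div_of_nonneg_right hmin hlam.le
    -- off-diagonal entry: `|W| ≤ Z_abs/λ`
    have hWabs : |W| ≤ headAbsSumI ℓ a b F Zabs / legendreLam ℓ := by
      rw [headAbsSumI, Finset.sum_div]
      refine (Finset.abs_sum_le_sum_abs _ _).trans (Finset.sum_le_sum fun q hq => ?_)
      rw [abs_mul, abs_of_nonneg (div_nonneg ((hA q).1.trans (hA q).2.1) hlam.le)]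
      have hZq := hZ q hq Δ hΔ
      have hZ0 : 0 ≤ Zabs q := (abs_nonneg _).trans hZq
      calc hrCoeff Δ ℓ q.1 q.2 / legendreLam ℓ * |_| ≤ hrCoeff Δ ℓ q.1 q.2 / legendreLam ℓ * Zabs q :=
            mul_le_mul_of_nonneg_left hZq (div_nonneg ((hA q).1.trans (hA q).2.1) hlam.le)
        _ ≤ hrCoeffHi a b ℓ q.1 q.2 * Zabs q / legendreLam ℓ := by
            rw [div_mul_eq_mul_div]
            exact div_le_div_of_nonneg_right (mul_le_mul_of_nonneg_right (hA q).2.2 hZ0) hlam.le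
    have hX0 : 0 ≤ headCellSumI ℓ a b F Φ₁lo / legendreLam ℓ := div_nonneg hX hlam.le
    have hY0 : 0 ≤ headCellSumI ℓ a b F Φ₂lo / legendreLam ℓ := div_nonneg hY hlam.le
    have hXpos : 0 ≤ X := hX0.trans hXlo
    have hYpos : 0 ≤ Y := hY0.trans hYlo
    refine quadForm_nonneg_of_det hXpos hYpos ?_ x y
    have hW2 : W ^ 2 ≤ (headAbsSumI ℓ a b F Zabs / legendreLam ℓ) ^ 2 := by
      have h1 : -(headAbsSumI ℓ a b F Zabs / legendreLam ℓ) ≤ W := by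
        linarith [neg_abs_le W]
      exact sq_le_sq' h1 ((le_abs_self W).trans hWabs)
    have hdet' : (headAbsSumI ℓ a b F Zabs / legendreLam ℓ) ^ 2 ≤
        4 * (headCellSumI ℓ a b F Φ₁lo / legendreLam ℓ) *
          (headCellSumI ℓ a b F Φ₂lo / legendreLam ℓ) := by
      rw [div_pow]
      have hre : 4 * (headCellSumI ℓ a b F Φ₁lo / legendreLam ℓ) *
          (headCellSumI ℓ a b F Φ₂lo / legendreLam ℓ) =
          4 * headCellSumI ℓ a b F Φ₁lo * headCellSumI ℓ a b F Φ₂lo / legendreLam ℓ ^ 2 := by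
        field_simp
      rw [hre]
      exact div_le_div_of_nonneg_right hdet (sq_nonneg _)
    calc W ^ 2 ≤ (headAbsSumI ℓ a b F Zabs / legendreLam ℓ) ^ 2 := hW2
      _ ≤ 4 * (headCellSumI ℓ a b F Φ₁lo / legendreLam ℓ) *
            (headCellSumI ℓ a b F Φ₂lo / legendreLam ℓ) := hdet'
      _ ≤ 4 * X * Y :=
          mul_le_mul (mul_le_mul_of_nonneg_left hXlo (by norm_num)) hYlo hY0
            (mul_nonneg (by norm_num) hXpos)
  · intro q hq hr x y
    exact htail q hq hr (Δ + (q.1 : ℝ)) ⟨by linarith [hΔ.1], by linarith [hΔ.2]⟩ x y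

/-- **Singlet head cell rule, half-open cell**: every `Δ ∈ [a, b)`, non-regular points by the limit
clause from the regular points to their right inside the cell.
[cite: KosPolandSimmonsduffin2014, §3.3 eq. (3.16)] -/
theorem singletPositive_ofPoints_of_headSumsI_Ico {N : ℕ} (z zb : Fin N → ℝ)
    (w : Fin 7 → Fin N → ℝ) (hz : ∀ k, z k ∈ Ioo (0 : ℝ) 1) (hzb : ∀ k, zb k ∈ Ioo (0 : ℝ) 1)
    {ℓ : ℕ} {a b Δφ Δs : ℝ} (ha : unitarityBound3D ℓ < a) (F : Finset (ℕ × ℕ))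
    (Φ₁lo Φ₂lo Zabs : ℕ × ℕ → ℝ)
    (hΦ₁ : ∀ q ∈ F, ∀ Δ ∈ Icc a b,
      Φ₁lo q ≤ pointFunctional (w 1) z zb (crossF Δφ (-1) (zMono (Δ + (q.1 : ℝ)) q.2)) +
        pointFunctional (w 2) z zb (crossF Δφ 1 (zMono (Δ + (q.1 : ℝ)) q.2)))
    (hΦ₂ : ∀ q ∈ F, ∀ Δ ∈ Icc a b,
      Φ₂lo q ≤ pointFunctional (w 3) z zb (crossF Δs (-1) (zMono (Δ + (q.1 : ℝ)) q.2)))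
    (hZ : ∀ q ∈ F, ∀ Δ ∈ Icc a b,
      |pointFunctional (w 5) z zb (crossF ((Δφ + Δs) / 2) (-1) (zMono (Δ + (q.1 : ℝ)) q.2)) +
        pointFunctional (w 6) z zb (crossF ((Δφ + Δs) / 2) 1 (zMono (Δ + (q.1 : ℝ)) q.2))| ≤ Zabs q)
    (hX : 0 ≤ headCellSumI ℓ a b F Φ₁lo) (hY : 0 ≤ headCellSumI ℓ a b F Φ₂lo)
    (hdet : headAbsSumI ℓ a b F Zabs ^ 2 ≤ 4 * headCellSumI ℓ a b F Φ₁lo * headCellSumI ℓ a b F Φ₂lo)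
    (htail : ∀ q : ℕ × ℕ, q ∉ F → InDescendantRange ℓ q.1 q.2 →
      ∀ E ∈ Icc (a + q.1) (b + q.1), ∀ x y : ℝ, 0 ≤ singletTermForm z zb w Δφ Δs E q.2 x y) :
    ∀ Δ ∈ Ico a b, (ofPoints z zb w).SingletPositive Δφ Δs Δ ℓ := by
  intro Δ hΔ
  have hreg := singletPositive_ofPoints_of_headSumsI z zb w hz hzb ha F Φ₁lo Φ₂lo Zabs hΦ₁ hΦ₂ hZ hX
    hY hdet htail
  by_cases hr : IsRegularPoint3D Δ ℓ
  · exact hreg Δ ⟨hΔ.1, hΔ.2.le⟩ hr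
  · have hbd : unitarityBound3D ℓ ≤ Δ := ha.le.trans hΔ.1
    refine singletPositive_ofPoints_of_eventually_right z zb w hz hzb Δφ Δs Δ ℓ hr ?_
    filter_upwards [eventually_isRegularPoint3D_nhdsGT_of_bound_le hbd, Ioo_mem_nhdsGT hΔ.2]
      with Δ' hΔ'reg hΔ'
    exact ⟨hΔ'reg, hreg Δ' ⟨hΔ.1.trans hΔ'.1.le, hΔ'.2.le⟩ hΔ'reg⟩

/-! ### The cell numbers -/

/-- The off-diagonal singlet term bound on a box: `max(|zm|, |zp|)` with the two two-weight corner
bounds `zm ≤ Φ_{w₅}[F^h_-] + Φ_{w₆}[F^h_+] ≤ -zp`. [cite: HogervorstRychkov2013, §3 eq. (3.9)] -/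
def singletOffDiagAbs {N : ℕ} (z zb : Fin N → ℝ) (w : Fin 7 → Fin N → ℝ) (j : ℕ)
    (E₁ E₂ hlo hhi : ℝ) : ℝ :=
  max |cornerBound₂ (w 5 + w 6) (w 5 - w 6) z zb j E₁ E₂ hlo hhi|
    |cornerBound₂ (-(w 5 + w 6)) (-(w 5 - w 6)) z zb j E₁ E₂ hlo hhi|

/-- `|Φ_{w₅}[F^h_-[𝒫_{E,j}]] + Φ_{w₆}[F^h_+[𝒫_{E,j}]]| ≤ singletOffDiagAbs` on the box.
[cite: HogervorstRychkov2013, §3 eq. (3.9)] -/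
theorem abs_sum56_le_singletOffDiagAbs {N : ℕ} (z zb : Fin N → ℝ) (w : Fin 7 → Fin N → ℝ)
    (hz : ∀ k, z k ∈ Ioo (0 : ℝ) 1) (hzb : ∀ k, zb k ∈ Ioo (0 : ℝ) 1) (j : ℕ)
    {E₁ E₂ hlo hhi E s : ℝ} (hE : E ∈ Icc E₁ E₂) (hs : s ∈ Icc hlo hhi) :
    |pointFunctional (w 5) z zb (crossF s (-1) (zMono E j)) +
        pointFunctional (w 6) z zb (crossF s 1 (zMono E j))| ≤
      singletOffDiagAbs z zb w j E₁ E₂ hlo hhi := by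
  rw [sum45_eq_twoWeightEval]
  set Z := twoWeightEval (w 5 + w 6) (w 5 - w 6) z zb s (zMono E j)
  have h1 : cornerBound₂ (w 5 + w 6) (w 5 - w 6) z zb j E₁ E₂ hlo hhi ≤ Z :=
    cornerBound₂_le _ _ z zb hz hzb j hE hs
  have h2 : Z ≤ -cornerBound₂ (-(w 5 + w 6)) (-(w 5 - w 6)) z zb j E₁ E₂ hlo hhi := by
    have h := cornerBound₂_le (-(w 5 + w 6)) (-(w 5 - w 6)) z zb hz hzb j hE hs
    rw [twoWeightEval_neg] at h
    linarith
  unfold singletOffDiagAbs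
  rw [abs_le]
  constructor
  · have : -|cornerBound₂ (w 5 + w 6) (w 5 - w 6) z zb j E₁ E₂ hlo hhi| ≤
        cornerBound₂ (w 5 + w 6) (w 5 - w 6) z zb j E₁ E₂ hlo hhi := neg_abs_le _
    linarith [le_max_left |cornerBound₂ (w 5 + w 6) (w 5 - w 6) z zb j E₁ E₂ hlo hhi|
      |cornerBound₂ (-(w 5 + w 6)) (-(w 5 - w 6)) z zb j E₁ E₂ hlo hhi|]
  · have : -cornerBound₂ (-(w 5 + w 6)) (-(w 5 - w 6)) z zb j E₁ E₂ hlo hhi ≤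
        |cornerBound₂ (-(w 5 + w 6)) (-(w 5 - w 6)) z zb j E₁ E₂ hlo hhi| := by
      rw [← abs_neg]; exact le_abs_self _
    linarith [le_max_right |cornerBound₂ (w 5 + w 6) (w 5 - w 6) z zb j E₁ E₂ hlo hhi|
      |cornerBound₂ (-(w 5 + w 6)) (-(w 5 - w 6)) z zb j E₁ E₂ hlo hhi|]

/-- The three numbers of a singlet head cell on the canonical head set: `X_lo` (`(1,1)` entry, the
two-weight corner bound with `(w₁+w₂, w₁−w₂)` on `[φ_lo,φ_hi]`), `Y_lo` (`(2,2)` entry, corner term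
bound of `w₃` on `[s_lo,s_hi]`), `Z_abs` (off-diagonal, on the `h`-box `[(φ_lo+s_lo)/2, (φ_hi+s_hi)/2]`).
[cite: KosPolandSimmonsduffin2014, §3.3 eq. (3.16)] -/
def singletHeadX {N : ℕ} (z zb : Fin N → ℝ) (w : Fin 7 → Fin N → ℝ) (ℓ : ℕ) (a b φlo φhi : ℝ)
    (nF : ℕ) : ℝ :=
  headCellSumI ℓ a b (headSet ℓ nF)
    (fun q => cornerBound₂ (w 1 + w 2) (w 1 - w 2) z zb q.2 (a + q.1) (b + q.1) φlo φhi)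

/-- See `singletHeadX`. [cite: KosPolandSimmonsduffin2014, §3.3 eq. (3.16)] -/
def singletHeadY {N : ℕ} (z zb : Fin N → ℝ) (w : Fin 7 → Fin N → ℝ) (ℓ : ℕ) (a b slo shi : ℝ)
    (nF : ℕ) : ℝ :=
  headCellSumI ℓ a b (headSet ℓ nF)
    (fun q => termCornerBound (w 3) z zb q.2 (a + q.1) (b + q.1) slo shi)

/-- See `singletHeadX`. [cite: KosPolandSimmonsduffin2014, §3.3 eq. (3.16)] -/
def singletHeadZ {N : ℕ} (z zb : Fin N → ℝ) (w : Fin 7 → Fin N → ℝ) (ℓ : ℕ)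
    (a b φlo φhi slo shi : ℝ) (nF : ℕ) : ℝ :=
  headAbsSumI ℓ a b (headSet ℓ nF)
    (fun q => singletOffDiagAbs z zb w q.2 (a + q.1) (b + q.1) ((φlo + slo) / 2) ((φhi + shi) / 2))

/-- **One light singlet cell from its three numbers.** In the dominated configuration (apex `a₀`),
for `(Δ_φ, Δ_s) ∈ Q ⊆ [φ_lo,φ_hi] × [s_lo,s_hi]`, with the singlet tail rules in force — (M_S) boxes on
`[E₀, E_T)` (`hM`, from `singletTermForm_nonneg_of_cornerBounds`) and the (T_S) apex numbers of
`singletTermForm_nonneg_of_apex` —, a `Δ`-cell `[a, b)` starting strictly above the unitarity bound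
with `a ≥ ℓ + τ`, head level `n_F` with `a + n_F + 1 ≥ E₀`, and `X_lo ≥ 0`, `Y_lo ≥ 0`,
`Z_abs² ≤ 4 X_lo Y_lo` give `SingletPositive` for every `p ∈ Q` at every `Δ ∈ [a, b)`.  The items
`scalar_S`, `spinning_S` are finite unions of such cells. [cite: KosPolandSimmonsduffin2014, §3.3 eq. (3.16)] -/
theorem singletCell_of_headNumbers {N : ℕ} (z zb : Fin N → ℝ) (w : Fin 7 → Fin N → ℝ)
    (hz : ∀ k, z k ∈ Ioo (0 : ℝ) 1) (hzb : ∀ k, zb k ∈ Ioo (0 : ℝ) 1) (hord : ∀ k, zb k ≤ z k)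
    (a₀ : Fin N) (qd qr : Fin N → ℝ) (hqd : ∀ k, 0 < qd k ∧ qd k ≤ 1)
    (hqr : ∀ k, 0 < qr k ∧ qr k ≤ 1)
    (hdomd : ∀ k, z k * zb k ≤ qd k ^ 2 * (z a₀ * zb a₀) ∧ z k ≤ qd k * z a₀)
    (hdomr : ∀ k, (1 - z k) * (1 - zb k) ≤ qr k ^ 2 * (z a₀ * zb a₀) ∧ 1 - zb k ≤ qr k * z a₀)
    {Q : Set (ℝ × ℝ)} {φlo φhi slo shi E₀ ET τ : ℝ}
    (hQ : ∀ p ∈ Q, (φlo ≤ p.1 ∧ p.1 ≤ φhi) ∧ (slo ≤ p.2 ∧ p.2 ≤ shi))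
    (hM : ∀ (j : ℕ) (E : ℝ), E₀ ≤ E → E < ET → (j : ℝ) + τ ≤ E → ∀ p ∈ Q,
      ∀ x y : ℝ, 0 ≤ singletTermForm z zb w p.1 p.2 E j x y)
    (h12 : 0 ≤ w 1 a₀ + w 2 a₀) (h3 : 0 ≤ w 3 a₀)
    (hXT : 0 ≤ (w 1 a₀ + w 2 a₀) * ((1 - z a₀) * (1 - zb a₀)) ^ φhi
      - apexRest (w 1) z zb a₀ qd qr φlo ET - apexRest (w 2) z zb a₀ qd qr φlo ET)
    (hYT : 0 ≤ w 3 a₀ * ((1 - z a₀) * (1 - zb a₀)) ^ shi - apexRest (w 3) z zb a₀ qd qr slo ET)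
    (hZT : (|w 5 a₀ + w 6 a₀| * ((1 - z a₀) * (1 - zb a₀)) ^ ((φlo + slo) / 2)
            + apexRest (w 5) z zb a₀ qd qr ((φlo + slo) / 2) ET
            + apexRest (w 6) z zb a₀ qd qr ((φlo + slo) / 2) ET) ^ 2 ≤
        4 * ((w 1 a₀ + w 2 a₀) * ((1 - z a₀) * (1 - zb a₀)) ^ φhi
              - apexRest (w 1) z zb a₀ qd qr φlo ET - apexRest (w 2) z zb a₀ qd qr φlo ET) *
          (w 3 a₀ * ((1 - z a₀) * (1 - zb a₀)) ^ shi - apexRest (w 3) z zb a₀ qd qr slo ET))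
    {ℓ : ℕ} {a b : ℝ} (ha : unitarityBound3D ℓ < a) (haτ : (ℓ : ℝ) + τ ≤ a) (nF : ℕ)
    (hnF : E₀ ≤ a + ((nF : ℝ) + 1))
    (hX : 0 ≤ singletHeadX z zb w ℓ a b φlo φhi nF) (hY : 0 ≤ singletHeadY z zb w ℓ a b slo shi nF)
    (hdet : singletHeadZ z zb w ℓ a b φlo φhi slo shi nF ^ 2 ≤
      4 * singletHeadX z zb w ℓ a b φlo φhi nF * singletHeadY z zb w ℓ a b slo shi nF) :
    ∀ p ∈ Q, ∀ Δ ∈ Ico a b, (ofPoints z zb w).SingletPositive p.1 p.2 Δ ℓ := by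
  intro p hp
  have hT := singletTermForm_nonneg_of_apex z zb w hz hzb hord a₀ qd qr hqd hqr hdomd hdomr h12 h3
    hXT hYT hZT
  refine singletPositive_ofPoints_of_headSumsI_Ico z zb w hz hzb ha (headSet ℓ nF) _ _ _ ?_ ?_ ?_ hX
    hY hdet ?_
  · intro q _ Δ hΔ
    exact (cornerBound₂_le _ _ z zb hz hzb q.2
      (⟨by linarith [hΔ.1], by linarith [hΔ.2]⟩ : Δ + (q.1 : ℝ) ∈ Icc (a + q.1) (b + q.1))
      (⟨(hQ p hp).1.1, (hQ p hp).1.2⟩ : p.1 ∈ Icc φlo φhi)).trans_eq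
      (sum45_eq_twoWeightEval _ _ z zb _ _).symm
  · intro q _ Δ hΔ
    exact termCornerBound_le (w 3) z zb hz hzb q.2
      (⟨by linarith [hΔ.1], by linarith [hΔ.2]⟩ : Δ + (q.1 : ℝ) ∈ Icc (a + q.1) (b + q.1))
      ⟨(hQ p hp).2.1, (hQ p hp).2.2⟩
  · intro q _ Δ hΔ
    exact abs_sum56_le_singletOffDiagAbs z zb w hz hzb q.2
      (⟨by linarith [hΔ.1], by linarith [hΔ.2]⟩ : Δ + (q.1 : ℝ) ∈ Icc (a + q.1) (b + q.1))
      ⟨by linarith [(hQ p hp).1.1, (hQ p hp).2.1], by linarith [(hQ p hp).1.2, (hQ p hp).2.2]⟩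
  · intro q hq hr E hE x y
    have hjb : (q.2 : ℝ) + τ ≤ E := by
      have h2 : (q.2 : ℝ) ≤ (ℓ : ℝ) + q.1 := by exact_mod_cast hr.2.1
      linarith [hE.1]
    have hjE : (q.2 : ℝ) ≤ E := by
      have h2 : (q.2 : ℝ) ≤ (ℓ : ℝ) + q.1 := by exact_mod_cast hr.2.1
      linarith [hE.1, natCast_add_half_le_unitarityBound3D ℓ]
    have hE0 : E₀ ≤ E := (headSet_off hnF q hq hr).trans hE.1
    by_cases hET : E < ET
    · exact hM q.2 E hE0 hET hjb p hp x y
    · exact hT E (not_lt.1 hET) q.2 hjE p.1 ⟨(hQ p hp).1.1, (hQ p hp).1.2⟩ p.2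
        ⟨(hQ p hp).2.1, (hQ p hp).2.2⟩ x y

/-! ### Light singlet rows from cell lists -/

/-- **A covered singlet range from cells**: half-open cells `[t_i, t_{i+1})`, `i < m`, with
`t_0 ≤ lo`, `hi ≤ t_m`, each carrying `SingletPositive` on `Q`, cover every `Δ ∈ [lo, hi)`.
Elementary. [cite: KosPolandSimmonsduffin2014, §3.3 eq. (3.16)] -/
theorem singletPositive_of_cells {N : ℕ} (z zb : Fin N → ℝ) (w : Fin 7 → Fin N → ℝ)
    {Q : Set (ℝ × ℝ)} {ℓ : ℕ} (t : ℕ → ℝ) (m : ℕ) {lo hi : ℝ}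
    (hlo : t 0 ≤ lo) (hhi : hi ≤ t m)
    (hcell : ∀ i < m, ∀ p ∈ Q, ∀ Δ ∈ Ico (t i) (t (i + 1)),
      (ofPoints z zb w).SingletPositive p.1 p.2 Δ ℓ) :
    ∀ p ∈ Q, ∀ Δ : ℝ, lo ≤ Δ → Δ < hi → (ofPoints z zb w).SingletPositive p.1 p.2 Δ ℓ := by
  intro p hp Δ h1 h2
  have hΔm : Δ < t m := lt_of_lt_of_le h2 hhi
  have h0 : t 0 ≤ Δ := hlo.trans h1
  have hex : ∃ i, i < m ∧ t i ≤ Δ ∧ Δ < t (i + 1) := by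
    by_contra hne
    push Not at hne
    have key : ∀ i, i ≤ m → t i ≤ Δ := by
      intro i
      induction i with
      | zero => intro _; exact h0
      | succ i ih =>
        intro hi'
        exact hne i (by omega) (ih (by omega))
    exact absurd (key m le_rfl) (not_le.2 hΔm)
  obtain ⟨i, him, hi1, hi2⟩ := hex
  exact hcell i him p hp Δ ⟨hi1, hi2⟩

/-- **The item `spinning_S` of one spin from a cell list**: cells covering `[ℓ+1, E₀)` give the light
singlet rows of the even spin `ℓ ≠ 0`. [cite: KosPolandSimmonsDuffinVichi2015, §2.2 (functional conditions)] -/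
theorem spinning_S_of_cells {N : ℕ} (z zb : Fin N → ℝ) (w : Fin 7 → Fin N → ℝ)
    {Q : Set (ℝ × ℝ)} {ℓ : ℕ} {E₀ : ℝ} (t : ℕ → ℝ) (m : ℕ)
    (hlo : t 0 ≤ (ℓ : ℝ) + 1) (hhi : E₀ ≤ t m)
    (hcell : ∀ i < m, ∀ p ∈ Q, ∀ Δ ∈ Ico (t i) (t (i + 1)),
      (ofPoints z zb w).SingletPositive p.1 p.2 Δ ℓ) :
    ∀ p ∈ Q, ∀ Δ : ℝ, (ℓ : ℝ) + 1 ≤ Δ → Δ < E₀ → (ofPoints z zb w).SingletPositive p.1 p.2 Δ ℓ :=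
  singletPositive_of_cells z zb w t m hlo hhi hcell

/-- **The item `scalar_S` from a cell list**: cells covering `[max(Δ_S^*, 1/2), E₀)` give the light
singlet scalars above the gap. [cite: KosPolandSimmonsDuffinVichi2015, §2.2 (functional conditions)] -/
theorem scalar_S_of_cells {N : ℕ} (z zb : Fin N → ℝ) (w : Fin 7 → Fin N → ℝ)
    {Q : Set (ℝ × ℝ)} {ΔSstar E₀ : ℝ} (t : ℕ → ℝ) (m : ℕ)
    (hlo : t 0 ≤ max ΔSstar (1 / 2)) (hhi : E₀ ≤ t m)
    (hcell : ∀ i < m, ∀ p ∈ Q, ∀ Δ ∈ Ico (t i) (t (i + 1)),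
      (ofPoints z zb w).SingletPositive p.1 p.2 Δ 0) :
    ∀ p ∈ Q, ∀ Δ : ℝ, ΔSstar ≤ Δ → 1 / 2 ≤ Δ → Δ < E₀ →
      (ofPoints z zb w).SingletPositive p.1 p.2 Δ 0 :=
  fun p hp Δ hg hb hE => singletPositive_of_cells z zb w t m le_rfl hhi hcell p hp Δ
    (hlo.trans (max_le hg hb)) hE

end ArchipelagoFunctional

end Literature.MathematicalPhysics.QuantumFieldTheory.ONArchipelagoSystem
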